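import Mathlib.Analysis.Convex.Cone.Extension
import Mathlib.MeasureTheory.Integral.RieszMarkovKakutani.Real
import Mathlib.MeasureTheory.Integral.Prod
import Mathlib.MeasureTheory.Measure.Regular
import Mathlib.Topology.ContinuousMap.Compact
import HarnessLib

/-!
# Kantorovich duality on compact metric spaces

For finite Borel measures `μ` on `X` and `ν` on `Y` of equal mass on compact metric spaces and a
continuous cost `c : X × Y → ℝ`, the Kantorovich problem
`inf { ∫ c dπ : π a coupling of μ and ν }` is attained and equals the dual value
`sup { ∫ φ dμ + ∫ ψ dν : φ ∈ C(X), ψ ∈ C(Y), φ(x) + ψ(y) ≤ c(x,y) }`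
(Kantorovich 1942; Villani, *Topics in Optimal Transportation* (2003), Thm. 1.3, here in the
compact case of §1.1.1, proof "by Hahn–Banach", §1.1.2 / Rem. 1.12).

Proof (the Hahn–Banach/Riesz route of Villani §1.1.2): on `E = C(X × Y)` the functional
`p(f) = inf { ∫ φ dμ + ∫ ψ dν : f ≤ φ ⊕ ψ }` is sublinear, monotone, with `p 0 = 0`; a linear
`g ≤ p` with `g(-c) = p(-c)` (analytic Hahn–Banach, `exists_extension_of_le_sublinear`) is
positive, hence (Riesz–Markov–Kakutani, `RealRMK.rieszMeasure`) `g f = ∫ f dπ` for a finite Borel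
measure `π` on `X × Y`; testing `g` on `φ ∘ fst`, `ψ ∘ snd` identifies the marginals, and
`∫ c dπ = -p(-c)` is the dual value, which by weak duality is `≤` the cost of every coupling.

## Main statements

* `IsCoupling μ ν π`: `π` has marginals `μ` and `ν`.
* `integral_add_integral_le_of_isCoupling`: weak duality.
* `exists_isCoupling_isLUB_integral`: there is a coupling `π` whose cost `∫ c dπ` is the least
  upper bound of the dual values — hence `π` is an optimal coupling
  (`exists_optimal_isCoupling`) and there is no duality gap.

Mathlib has no optimal transport (searched `Kantorovich|Wasserstein|coupling`): this file is the
tree's entry point; the Kantorovich–Rubinstein form for metric costs is built on top of it.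
-/

noncomputable section

open _root_.MeasureTheory _root_.MeasureTheory.Measure Set Filter CompactlySupported
open scoped Topology

namespace Literature.MeasureTheory.OptimalTransport

section General

variable {X Y : Type*} [MeasurableSpace X] [MeasurableSpace Y]

/-- A **coupling** (transport plan) of the measures `μ` on `X` and `ν` on `Y`: a measure on
`X × Y` with first marginal `μ` and second marginal `ν` (Villani 2003, §1.1.1, `Π(μ, ν)`).
[cite: Villani2003, §1.1.1] -/
structure IsCoupling (μ : Measure X) (ν : Measure Y) (π : Measure (X × Y)) : Prop where
  /-- The first marginal is `μ`. -/
  map_fst : π.map Prod.fst = μ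
  /-- The second marginal is `ν`. -/
  map_snd : π.map Prod.snd = ν

namespace IsCoupling

variable {μ : Measure X} {ν : Measure Y} {π : Measure (X × Y)}

/-- A coupling of finite measures is finite. [folklore] -/
theorem isFiniteMeasure [IsFiniteMeasure μ] (h : IsCoupling μ ν π) : IsFiniteMeasure π := by
  constructor
  have : π univ = μ univ := by
    rw [← h.map_fst, Measure.map_apply measurable_fst MeasurableSet.univ, preimage_univ]
  rw [this]
  exact measure_lt_top μ univ

/-- The two marginals of a coupling have the same total mass. [folklore] -/
theorem measure_univ_eq (h : IsCoupling μ ν π) : μ univ = ν univ := by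
  rw [← h.map_fst, ← h.map_snd, Measure.map_apply measurable_fst MeasurableSet.univ,
    Measure.map_apply measurable_snd MeasurableSet.univ, preimage_univ, preimage_univ]

/-- Integration of a function of the first variable against a coupling. [folklore] -/
theorem integral_comp_fst (h : IsCoupling μ ν π) {φ : X → ℝ} (hφ : AEStronglyMeasurable φ μ) :
    ∫ z, φ z.1 ∂π = ∫ x, φ x ∂μ := by
  rw [← h.map_fst, integral_map measurable_fst.aemeasurable (h.map_fst ▸ hφ)]

/-- Integration of a function of the second variable against a coupling. [folklore] -/
theorem integral_comp_snd (h : IsCoupling μ ν π) {ψ : Y → ℝ} (hψ : AEStronglyMeasurable ψ ν) :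
    ∫ z, ψ z.2 ∂π = ∫ y, ψ y ∂ν := by
  rw [← h.map_snd, integral_map measurable_snd.aemeasurable (h.map_snd ▸ hψ)]

/-- The product coupling `(μ univ)⁻¹ • μ ⊗ ν` of two finite measures of equal nonzero mass.
[folklore] -/
theorem prod_smul [IsFiniteMeasure μ] [SFinite ν] (hmass : μ univ = ν univ)
    (h0 : μ univ ≠ 0) : IsCoupling μ ν ((μ univ)⁻¹ • μ.prod ν) := by
  have htop : μ univ ≠ ⊤ := measure_ne_top μ univ
  constructor
  · rw [Measure.map_smul, Measure.map_fst_prod, ← hmass, smul_smul,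
      ENNReal.inv_mul_cancel h0 htop, one_smul]
  · rw [Measure.map_smul, Measure.map_snd_prod, smul_smul, ENNReal.inv_mul_cancel h0 htop,
      one_smul]

end IsCoupling

end General

variable {X Y : Type*} [MetricSpace X] [CompactSpace X] [MeasurableSpace X] [BorelSpace X]
  [MetricSpace Y] [CompactSpace Y] [MeasurableSpace Y] [BorelSpace Y]

/-! ### Continuous functions on compact spaces: integrability bookkeeping -/

/-- Continuous real functions on a compact metric space are integrable for finite Borel measures.
[folklore] -/
theorem integrable_continuousMap {Z : Type*} [MetricSpace Z] [CompactSpace Z] [MeasurableSpace Z]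
    [OpensMeasurableSpace Z] (μ : Measure Z) [IsFiniteMeasure μ] (φ : C(Z, ℝ)) : Integrable φ μ :=
  (map_continuous φ).integrable_of_hasCompactSupport (HasCompactSupport.of_compactSpace _)

/-! ### Weak duality -/

section WeakDuality

variable {μ : Measure X} {ν : Measure Y} {π : Measure (X × Y)}

/-- **Weak duality**: if `φ(x) + ψ(y) ≤ c(x, y)` everywhere then
`∫ φ dμ + ∫ ψ dν ≤ ∫ c dπ` for every coupling `π` of the finite measures `μ`, `ν`
(Villani 2003, §1.1.1, the "easy" inequality). [cite: Villani2003, Thm. 1.3] -/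
theorem integral_add_integral_le_of_isCoupling [IsFiniteMeasure μ] (h : IsCoupling μ ν π)
    {φ : C(X, ℝ)} {ψ : C(Y, ℝ)} {c : C(X × Y, ℝ)} (hle : ∀ x y, φ x + ψ y ≤ c (x, y)) :
    ∫ x, φ x ∂μ + ∫ y, ψ y ∂ν ≤ ∫ z, c z ∂π := by
  haveI := h.isFiniteMeasure
  haveI : IsFiniteMeasure ν := by
    constructor; rw [← h.measure_univ_eq]; exact measure_lt_top μ univ
  rw [← h.integral_comp_fst (integrable_continuousMap μ φ).aestronglyMeasurable,
    ← h.integral_comp_snd (integrable_continuousMap ν ψ).aestronglyMeasurable,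
    ← integral_add]
  · refine integral_mono ?_ (integrable_continuousMap π c) fun z => hle z.1 z.2
    exact (integrable_continuousMap π (φ.comp ContinuousMap.fst)).add
      (integrable_continuousMap π (ψ.comp ContinuousMap.snd))
  · exact integrable_continuousMap π (φ.comp ContinuousMap.fst)
  · exact integrable_continuousMap π (ψ.comp ContinuousMap.snd)

end WeakDuality

/-! ### The upper dual functional and its sublinearity -/

section Upper

variable (μ : Measure X) (ν : Measure Y)

/-- The values `∫ φ dμ + ∫ ψ dν` over continuous super-solutions `f ≤ φ ⊕ ψ`. [folklore] -/
def superValues (f : C(X × Y, ℝ)) : Set ℝ :=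
  {r | ∃ (φ : C(X, ℝ)) (ψ : C(Y, ℝ)), (∀ x y, f (x, y) ≤ φ x + ψ y) ∧
    r = ∫ x, φ x ∂μ + ∫ y, ψ y ∂ν}

/-- The **dual values** `∫ φ dμ + ∫ ψ dν` over continuous sub-solutions `φ ⊕ ψ ≤ c` of the
Kantorovich dual problem (Villani 2003, Thm. 1.3, right-hand side of (1.3) restricted to
`C_b = C` on compact spaces, Rem. 1.12). [cite: Villani2003, Thm. 1.3] -/
def dualValues (c : C(X × Y, ℝ)) : Set ℝ :=
  {r | ∃ (φ : C(X, ℝ)) (ψ : C(Y, ℝ)), (∀ x y, φ x + ψ y ≤ c (x, y)) ∧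
    r = ∫ x, φ x ∂μ + ∫ y, ψ y ∂ν}

/-- The sublinear functional `p f = inf { ∫ φ dμ + ∫ ψ dν : f ≤ φ ⊕ ψ }` of the Hahn–Banach
proof of Kantorovich duality (Villani 2003, §1.1.2). [cite: Villani2003, §1.1.2] -/
def upperValue (f : C(X × Y, ℝ)) : ℝ :=
  sInf (superValues μ ν f)

variable {μ ν}

omit [BorelSpace X] [BorelSpace Y] in
/-- `(‖f‖, 0)` is a super-solution, so the set of super-values is nonempty. [folklore] -/
theorem superValues_nonempty [IsFiniteMeasure μ] [IsFiniteMeasure ν] (f : C(X × Y, ℝ)) :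
    (superValues μ ν f).Nonempty := by
  refine ⟨_, ContinuousMap.const X ‖f‖, 0, fun x y => ?_, rfl⟩
  have h := ContinuousMap.norm_coe_le_norm f (x, y)
  rw [Real.norm_eq_abs] at h
  simpa using (le_abs_self _).trans h

/-- The key lower bound: a super-solution of `f` has value `≥ -‖f‖ μ(X)` (integrate
`f ≤ φ ⊕ ψ` against `μ ⊗ ν` and use equality of the masses). [folklore] -/
theorem neg_le_of_mem_superValues [IsFiniteMeasure μ] [IsFiniteMeasure ν]
    (hmass : μ univ = ν univ) {f : C(X × Y, ℝ)} {r : ℝ} (hr : r ∈ superValues μ ν f) :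
    -(‖f‖ * μ.real univ) ≤ r := by
  obtain ⟨φ, ψ, hle, rfl⟩ := hr
  set m := μ.real univ with hm
  have hmν : ν.real univ = m := by rw [hm, measureReal_def, measureReal_def, hmass]
  rcases eq_or_ne (μ univ) 0 with h0 | h0
  · have hμ : μ = 0 := Measure.measure_univ_eq_zero.mp h0
    have hν : ν = 0 := Measure.measure_univ_eq_zero.mp (hmass ▸ h0)
    have : m = 0 := by rw [hm, measureReal_def, h0, ENNReal.toReal_zero]
    simp [hμ, hν, this]
  have hmpos : 0 < m := by
    rw [hm, measureReal_def]
    exact ENNReal.toReal_pos h0 (measure_ne_top μ univ)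
  -- integrate over the product measure
  have hφ : Integrable φ μ := integrable_continuousMap μ φ
  have hψ : Integrable ψ ν := integrable_continuousMap ν ψ
  let F : C(X × Y, ℝ) := φ.comp ContinuousMap.fst + ψ.comp ContinuousMap.snd
  have hF : Integrable F (μ.prod ν) := integrable_continuousMap (μ.prod ν) F
  have hF_eq : ∫ z, F z ∂μ.prod ν = m * ∫ x, φ x ∂μ + m * ∫ y, ψ y ∂ν := by
    rw [integral_prod _ hF]
    have inner : ∀ x, ∫ y, F (x, y) ∂ν = m * φ x + ∫ y, ψ y ∂ν := by
      intro x
      have : (fun y => F (x, y)) = fun y => φ x + ψ y := by ext y; simp [F]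
      rw [this, integral_add (integrable_const _) hψ, integral_const, hmν, smul_eq_mul]
    simp_rw [inner]
    rw [integral_add (hφ.const_mul m) (integrable_const _), integral_const_mul, integral_const,
      smul_eq_mul, ← hm]
  have hf_int : Integrable f (μ.prod ν) := integrable_continuousMap (μ.prod ν) f
  have h1 : ∫ z, f z ∂μ.prod ν ≤ ∫ z, F z ∂μ.prod ν :=
    integral_mono hf_int hF fun z => by simpa [F] using hle z.1 z.2
  have h2 : -(‖f‖ * (m * m)) ≤ ∫ z, f z ∂μ.prod ν := by
    have hb := norm_integral_le_of_norm_le_const (μ := μ.prod ν) (f := fun z => f z) (C := ‖f‖)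
      (Eventually.of_forall fun z => ContinuousMap.norm_coe_le_norm f z)
    have hreal : (μ.prod ν).real univ = m * m := by
      rw [measureReal_def, ← univ_prod_univ, Measure.prod_prod, ENNReal.toReal_mul,
        ← measureReal_def, ← measureReal_def, hmν]
    rw [hreal, Real.norm_eq_abs] at hb
    have := neg_abs_le (∫ z, f z ∂μ.prod ν)
    nlinarith
  have key : -(‖f‖ * m) * m ≤ (∫ x, φ x ∂μ + ∫ y, ψ y ∂ν) * m := by nlinarith
  exact le_of_mul_le_mul_right key hmpos

/-- The super-values are bounded below (by `-‖f‖ μ(X)`). [folklore] -/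
theorem bddBelow_superValues [IsFiniteMeasure μ] [IsFiniteMeasure ν] (hmass : μ univ = ν univ)
    (f : C(X × Y, ℝ)) : BddBelow (superValues μ ν f) :=
  ⟨_, fun _ hr => neg_le_of_mem_superValues hmass hr⟩

variable [IsFiniteMeasure μ] [IsFiniteMeasure ν]

/-- `p f ≤ ∫ φ dμ + ∫ ψ dν` for every super-solution `f ≤ φ ⊕ ψ`. [folklore] -/
theorem upperValue_le (hmass : μ univ = ν univ) {f : C(X × Y, ℝ)} {φ : C(X, ℝ)} {ψ : C(Y, ℝ)}
    (h : ∀ x y, f (x, y) ≤ φ x + ψ y) :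
    upperValue μ ν f ≤ ∫ x, φ x ∂μ + ∫ y, ψ y ∂ν :=
  csInf_le (bddBelow_superValues hmass f) ⟨φ, ψ, h, rfl⟩

omit [IsFiniteMeasure μ] [IsFiniteMeasure ν] [BorelSpace X] [BorelSpace Y] in
/-- A common lower bound of all super-values is `≤ p f`. [folklore] -/
theorem le_upperValue [IsFiniteMeasure μ] [IsFiniteMeasure ν] {f : C(X × Y, ℝ)} {b : ℝ}
    (h : ∀ (φ : C(X, ℝ)) (ψ : C(Y, ℝ)), (∀ x y, f (x, y) ≤ φ x + ψ y) →
      b ≤ ∫ x, φ x ∂μ + ∫ y, ψ y ∂ν) :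
    b ≤ upperValue μ ν f :=
  le_csInf (superValues_nonempty f) (by rintro r ⟨φ, ψ, hle, rfl⟩; exact h φ ψ hle)

omit [BorelSpace X] [BorelSpace Y] in
/-- Approximate minimisers: if `p f < t` some super-solution has value `< t`. [folklore] -/
theorem exists_lt_of_upperValue_lt {f : C(X × Y, ℝ)} {t : ℝ} (ht : upperValue μ ν f < t) :
    ∃ (φ : C(X, ℝ)) (ψ : C(Y, ℝ)), (∀ x y, f (x, y) ≤ φ x + ψ y) ∧
      ∫ x, φ x ∂μ + ∫ y, ψ y ∂ν < t := by
  obtain ⟨r, ⟨φ, ψ, hle, rfl⟩, hlt⟩ := exists_lt_of_csInf_lt (superValues_nonempty f) ht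
  exact ⟨φ, ψ, hle, hlt⟩

/-- `p` is monotone. [folklore] -/
theorem upperValue_mono (hmass : μ univ = ν univ) {f g : C(X × Y, ℝ)} (hfg : ∀ z, f z ≤ g z) :
    upperValue μ ν f ≤ upperValue μ ν g :=
  le_upperValue fun _ _ h => upperValue_le hmass fun x y => (hfg _).trans (h x y)

/-- `p` is subadditive (add approximate minimisers). [folklore] -/
theorem upperValue_add_le (hmass : μ univ = ν univ) (f g : C(X × Y, ℝ)) :
    upperValue μ ν (f + g) ≤ upperValue μ ν f + upperValue μ ν g := by
  refine le_of_forall_pos_lt_add fun ε hε => ?_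
  obtain ⟨φ₁, ψ₁, h₁, hlt₁⟩ :=
    exists_lt_of_upperValue_lt (lt_add_of_pos_right (upperValue μ ν f) (half_pos hε))
  obtain ⟨φ₂, ψ₂, h₂, hlt₂⟩ :=
    exists_lt_of_upperValue_lt (lt_add_of_pos_right (upperValue μ ν g) (half_pos hε))
  have hfeas : ∀ x y, (f + g) (x, y) ≤ (φ₁ + φ₂) x + (ψ₁ + ψ₂) y := fun x y => by
    simp only [ContinuousMap.add_apply]
    linarith [h₁ x y, h₂ x y]
  have := upperValue_le hmass hfeas
  simp only [ContinuousMap.coe_add, Pi.add_apply] at this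
  rw [integral_add (integrable_continuousMap μ φ₁) (integrable_continuousMap μ φ₂),
    integral_add (integrable_continuousMap ν ψ₁) (integrable_continuousMap ν ψ₂)] at this
  linarith

/-- `p (t • f) ≤ t p f` for `t > 0` (scale super-solutions). [folklore] -/
theorem upperValue_smul_le (hmass : μ univ = ν univ) {t : ℝ} (ht : 0 < t) (f : C(X × Y, ℝ)) :
    upperValue μ ν (t • f) ≤ t * upperValue μ ν f := by
  rw [← div_le_iff₀' ht]
  refine le_upperValue fun φ ψ h => ?_
  rw [div_le_iff₀' ht]
  have hfeas : ∀ x y, (t • f) (x, y) ≤ (t • φ) x + (t • ψ) y := fun x y => by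
    simp only [ContinuousMap.smul_apply, smul_eq_mul]
    nlinarith [h x y]
  refine (upperValue_le hmass hfeas).trans_eq ?_
  simp only [ContinuousMap.coe_smul, Pi.smul_apply, smul_eq_mul]
  rw [integral_const_mul, integral_const_mul, mul_add]

/-- `p` is positively homogeneous. [folklore] -/
theorem upperValue_smul (hmass : μ univ = ν univ) {t : ℝ} (ht : 0 < t) (f : C(X × Y, ℝ)) :
    upperValue μ ν (t • f) = t * upperValue μ ν f := by
  refine le_antisymm (upperValue_smul_le hmass ht f) ?_
  have := upperValue_smul_le hmass (inv_pos.mpr ht) (t • f)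
  rw [smul_smul, inv_mul_cancel₀ ht.ne', one_smul, ← div_eq_inv_mul, le_div_iff₀ ht,
    mul_comm] at this
  exact this

/-- `p 0 = 0` (this uses the equality of the masses through the lower bound). [folklore] -/
theorem upperValue_zero (hmass : μ univ = ν univ) : upperValue μ ν (0 : C(X × Y, ℝ)) = 0 := by
  refine le_antisymm ?_ (le_upperValue fun φ ψ h => ?_)
  · have := upperValue_le hmass (f := 0) (φ := 0) (ψ := 0) fun x y => by simp
    simpa using this
  · have := neg_le_of_mem_superValues hmass ⟨φ, ψ, h, rfl⟩
    simpa using this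

/-- `0 ≤ p f + p (-f)`, the consistency condition for the one-dimensional Hahn–Banach
start. [folklore] -/
theorem upperValue_add_neg_nonneg (hmass : μ univ = ν univ) (f : C(X × Y, ℝ)) :
    0 ≤ upperValue μ ν f + upperValue μ ν (-f) := by
  have := upperValue_add_le hmass f (-f)
  rwa [add_neg_cancel, upperValue_zero hmass] at this

/-- **Hahn–Banach step**: a linear functional on `C(X × Y)` dominated by the upper dual
functional `p` and equal to it at a prescribed point `c'` (Villani 2003, §1.1.2).
[cite: Villani2003, §1.1.2] -/
theorem exists_linearMap_le_upperValue (hmass : μ univ = ν univ) (c' : C(X × Y, ℝ)) :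
    ∃ g : C(X × Y, ℝ) →ₗ[ℝ] ℝ,
      (∀ f, g f ≤ upperValue μ ν f) ∧ g c' = upperValue μ ν c' := by
  have H : ∀ t : ℝ, t • c' = 0 → (RingHom.id ℝ) t • upperValue μ ν c' = 0 := by
    intro t ht
    rcases eq_or_ne t 0 with rfl | ht0
    · simp
    · have hc : c' = 0 := by simpa [ht0] using ht
      simp [hc, upperValue_zero hmass]
  let f₀ : C(X × Y, ℝ) →ₗ.[ℝ] ℝ := LinearPMap.mkSpanSingleton' c' (upperValue μ ν c') H
  have hdom : f₀.domain = Submodule.span ℝ {c'} := LinearPMap.domain_mkSpanSingleton _ _ _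
  have hf : ∀ z : f₀.domain, f₀ z ≤ upperValue μ ν z := by
    rintro ⟨z, hz⟩
    obtain ⟨t, rfl⟩ := Submodule.mem_span_singleton.mp (hdom ▸ hz)
    change LinearPMap.mkSpanSingleton' c' (upperValue μ ν c') H ⟨t • c', hz⟩ ≤
      upperValue μ ν (t • c')
    rw [LinearPMap.mkSpanSingleton'_apply]
    simp only [RingHom.id_apply, smul_eq_mul]
    rcases lt_trichotomy t 0 with ht | rfl | ht
    · have h1 : upperValue μ ν (t • c') = (-t) * upperValue μ ν (-c') := by
        rw [← upperValue_smul hmass (neg_pos.mpr ht)]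
        congr 1
        rw [smul_neg, neg_smul, neg_neg]
      have h2 := upperValue_add_neg_nonneg hmass c'
      rw [h1]
      nlinarith
    · simp [upperValue_zero hmass]
    · rw [upperValue_smul hmass ht]
  obtain ⟨g, hg_eq, hg_le⟩ := exists_extension_of_le_sublinear f₀ (upperValue μ ν)
    (fun t ht f => upperValue_smul hmass ht f) (upperValue_add_le hmass) hf
  refine ⟨g, hg_le, ?_⟩
  have hmem : c' ∈ f₀.domain := hdom ▸ Submodule.mem_span_singleton_self c'
  rw [hg_eq ⟨c', hmem⟩]
  exact LinearPMap.mkSpanSingleton'_apply_self c' (upperValue μ ν c') H hmem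

end Upper

/-! ### Kantorovich duality with primal attainment -/

section Main

variable {μ : Measure X} {ν : Measure Y} [IsFiniteMeasure μ] [IsFiniteMeasure ν]

/-- **Kantorovich duality, compact case, with existence of an optimal transport plan**
(Kantorovich 1942; Villani 2003, Thm. 1.3 for compact `X`, `Y` and continuous cost, together
with the existence part proved in §1.1.2): for finite Borel measures `μ`, `ν` of equal mass
on compact metric spaces and a continuous cost `c`, there is a coupling `π` of `μ` and `ν`
whose cost `∫ c dπ` is the supremum of the dual values `∫ φ dμ + ∫ ψ dν`, `φ ⊕ ψ ≤ c`.
By weak duality `π` is then an optimal plan and there is no duality gap.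
[cite: Villani2003, Thm. 1.3] -/
theorem exists_isCoupling_isLUB_integral (hmass : μ univ = ν univ) (c : C(X × Y, ℝ)) :
    ∃ π : Measure (X × Y), IsCoupling μ ν π ∧ IsLUB (dualValues μ ν c) (∫ z, c z ∂π) := by
  obtain ⟨g, hg_le, hg_eq⟩ := exists_linearMap_le_upperValue hmass (-c)
  set p := upperValue μ ν with hp
  have g_nonneg : ∀ f : C(X × Y, ℝ), (∀ z, 0 ≤ f z) → 0 ≤ g f := by
    intro f hf
    have h1 : g (-f) ≤ p (-f) := hg_le _
    have h2 : p (-f) ≤ p 0 := upperValue_mono hmass fun z => by simpa using hf z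
    rw [hp, upperValue_zero hmass] at h2
    rw [map_neg] at h1
    linarith
  -- the positive linear functional on `C_c(X × Y) = C(X × Y)`
  let Λ : C_c(X × Y, ℝ) →ₚ[ℝ] ℝ :=
    { toFun := fun F => g F.toContinuousMap
      map_add' := fun F G => by
        change g (F.toContinuousMap + G.toContinuousMap) = _
        exact map_add g _ _
      map_smul' := fun t F => by
        change g (t • F.toContinuousMap) = _
        exact map_smul g _ _
      monotone' := fun F G hFG => by
        have : 0 ≤ g (G.toContinuousMap - F.toContinuousMap) :=
          g_nonneg _ fun z => sub_nonneg.mpr (hFG z)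
        change g F.toContinuousMap ≤ g G.toContinuousMap
        rw [map_sub] at this
        linarith }
  let π : Measure (X × Y) := RealRMK.rieszMeasure Λ
  have hint : ∀ f : C(X × Y, ℝ), ∫ z, f z ∂π = g f := fun f =>
    RealRMK.integral_rieszMeasure Λ ⟨f, HasCompactSupport.of_compactSpace f⟩
  -- identification of the marginals
  have hfst : ∀ φ : C(X, ℝ), g (φ.comp ContinuousMap.fst) = ∫ x, φ x ∂μ := by
    intro φ
    apply le_antisymm
    · calc g _ ≤ p (φ.comp ContinuousMap.fst) := hg_le _
        _ ≤ ∫ x, φ x ∂μ + ∫ y, (0 : C(Y, ℝ)) y ∂ν := upperValue_le hmass fun x y => by simp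
        _ = ∫ x, φ x ∂μ := by simp
    · have h1 : g (-(φ.comp ContinuousMap.fst)) ≤ p ((-φ).comp ContinuousMap.fst) := hg_le _
      have h2 : p ((-φ).comp ContinuousMap.fst) ≤ ∫ x, (-φ) x ∂μ + ∫ y, (0 : C(Y, ℝ)) y ∂ν :=
        upperValue_le hmass fun x y => by simp
      simp only [ContinuousMap.coe_neg, Pi.neg_apply, integral_neg, ContinuousMap.coe_zero,
        Pi.zero_apply, integral_zero, add_zero] at h2
      rw [map_neg] at h1
      linarith
  have hsnd : ∀ ψ : C(Y, ℝ), g (ψ.comp ContinuousMap.snd) = ∫ y, ψ y ∂ν := by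
    intro ψ
    apply le_antisymm
    · calc g _ ≤ p (ψ.comp ContinuousMap.snd) := hg_le _
        _ ≤ ∫ x, (0 : C(X, ℝ)) x ∂μ + ∫ y, ψ y ∂ν := upperValue_le hmass fun x y => by simp
        _ = ∫ y, ψ y ∂ν := by simp
    · have h1 : g (-(ψ.comp ContinuousMap.snd)) ≤ p ((-ψ).comp ContinuousMap.snd) := hg_le _
      have h2 : p ((-ψ).comp ContinuousMap.snd) ≤ ∫ x, (0 : C(X, ℝ)) x ∂μ + ∫ y, (-ψ) y ∂ν :=
        upperValue_le hmass fun x y => by simp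
      simp only [ContinuousMap.coe_neg, Pi.neg_apply, integral_neg, ContinuousMap.coe_zero,
        Pi.zero_apply, integral_zero, zero_add] at h2
      rw [map_neg] at h1
      linarith
  have coupling : IsCoupling μ ν π := by
    constructor
    · apply Measure.ext_of_integral_eq_on_compactlySupported
      intro F
      rw [integral_map measurable_fst.aemeasurable (map_continuous F).aestronglyMeasurable]
      exact (hint (F.toContinuousMap.comp ContinuousMap.fst)).trans (hfst F.toContinuousMap)
    · apply Measure.ext_of_integral_eq_on_compactlySupported
      intro F
      rw [integral_map measurable_snd.aemeasurable (map_continuous F).aestronglyMeasurable]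
      exact (hint (F.toContinuousMap.comp ContinuousMap.snd)).trans (hsnd F.toContinuousMap)
  refine ⟨π, coupling, ?_, ?_⟩
  · rintro r ⟨φ, ψ, hle, rfl⟩
    exact integral_add_integral_le_of_isCoupling coupling hle
  · intro b hb
    rw [hint c, show g c = -p (-c) by rw [← hg_eq, map_neg, neg_neg]]
    refine le_of_forall_pos_lt_add fun ε hε => ?_
    obtain ⟨φ, ψ, hle, hlt⟩ :=
      exists_lt_of_upperValue_lt (lt_add_of_pos_right (p (-c)) hε)
    have hmem : -(∫ x, φ x ∂μ + ∫ y, ψ y ∂ν) ∈ dualValues μ ν c := by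
      refine ⟨-φ, -ψ, fun x y => ?_, ?_⟩
      · have := hle x y
        simp only [ContinuousMap.neg_apply] at this ⊢
        linarith
      · simp [integral_neg]; ring
    have := hb hmem
    linarith

/-- **Existence of an optimal transport plan** and **absence of a duality gap**, unpacked:
there is a coupling `π` of `μ`, `ν` such that (i) `∫ c dπ ≤ ∫ c dπ'` for every coupling `π'`
and (ii) for every `ε > 0` some continuous sub-solution `φ ⊕ ψ ≤ c` has
`∫ c dπ - ε < ∫ φ dμ + ∫ ψ dν` (Villani 2003, Thm. 1.3 and §1.1.2).
[cite: Villani2003, Thm. 1.3] -/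
theorem exists_optimal_isCoupling (hmass : μ univ = ν univ) (c : C(X × Y, ℝ)) :
    ∃ π : Measure (X × Y), IsCoupling μ ν π ∧
      (∀ π' : Measure (X × Y), IsCoupling μ ν π' → ∫ z, c z ∂π ≤ ∫ z, c z ∂π') ∧
      ∀ ε : ℝ, 0 < ε → ∃ (φ : C(X, ℝ)) (ψ : C(Y, ℝ)), (∀ x y, φ x + ψ y ≤ c (x, y)) ∧
        ∫ z, c z ∂π - ε < ∫ x, φ x ∂μ + ∫ y, ψ y ∂ν := by
  obtain ⟨π, hπ, hlub⟩ := exists_isCoupling_isLUB_integral hmass c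
  refine ⟨π, hπ, fun π' hπ' => ?_, fun ε hε => ?_⟩
  · exact hlub.2 fun r ⟨φ, ψ, hle, hr⟩ => hr ▸ integral_add_integral_le_of_isCoupling hπ' hle
  · have : ¬ (∫ z, c z ∂π - ε) ∈ upperBounds (dualValues μ ν c) := fun h => by
      have := hlub.2 h
      linarith
    simp only [mem_upperBounds, not_forall, not_le, exists_prop] at this
    obtain ⟨r, ⟨φ, ψ, hle, rfl⟩, hlt⟩ := this
    exact ⟨φ, ψ, hle, hlt⟩

end Main

end Literature.MeasureTheory.OptimalTransport
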